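import Summits.FinalStateConjecture.FinalStateConjecture.Cruxes.KillingSpinorEndgame.Lines.birth

/-!
# Minimal restatement of the crux `KillingSpinorEndgame` (stmt-FinalStateConjecture-17645) and of its
# companion `KerrBasinCapture` (stmt-17646), with the route's deciding theorem RE-PROVED — continuation lead c3

Scratch for the PLANNER (statement items are the planner's; nothing here is proposed to the tree as a statement).
It complements `Lines/registered_restated_c1.lean` (c1) by three things:

1. **F6 applied** (Theorems/KerrnessPropagatesKillingSpinorEndgameInteriorIdle.lean, `killingSpinorEndgame_iff_honest`):
   ENDGAME's interior-lemma hypothesis (ii) and the `RaysStayInClosure` conjunct of its conclusion are logically idle, so the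
   restated ENDGAME concludes `Birth.HonestExterior 𝒟` outright and carries no hypothesis (ii); the interior lemma stays
   where it is produced — inside CAPTURE's generic property — and is consumed by the deciding theorem (`closes_restated`).
2. **The minimal ESSENTIAL repair is F2 only**: add `IsOrthochronous (mo i).1` to the configuration's side conditions
   (`OrthoConfig`), in BOTH items. This removes the white-hole sector on which the filed clause (i) certifies nothing late
   (geon witness, `Lines/registered_dead.md` §2) and on which every capture-type stub is false. The filed nine slab clauses
   (`Birth.Recurs`, token-identical with the route file) are kept VERBATIM, label quantifier included: on the orthochronous
   sector the idle lateness label (F1) does not change the truth value (an `ε`-good INGOING slab for every `ε` with forced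
   radii `Rᵢ ≳ Mᵢ/ε`, p157398, either sits on an exactly-Kerr ingoing slab region — whose future domain of dependence is the
   whole future exterior — or is forced late by `ε → 0`), so F1 may be repaired additionally (c1's label-free
   `Disjoint (Φ '' {x⁰ = τ}) (J⁻ K)`) or not, at the planner's discretion; the skeleton below does not depend on that choice.
3. **The assembly still closes**: `closes_restated : MaximalDevelopmentExists → KerrBasinCaptureOrtho →
   KillingSpinorEndgameOrtho → FinalStateConjecture`, proved exactly like the route file's `closes` (monotonicity of tame
   genericity), the interior lemma of `Q_k` now applied in the deciding theorem. And the filed crux implies the restated one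
   (`killingSpinorEndgameOrtho_of_filed`), so nothing provable is lost.

Two-stub re-line over the restated crux: `Sig.stub_dynamicsOrtho` (open problem: the whole difficulty) and
`Sig.stub_packagingOrtho` (XL causal bookkeeping, w2), composition `killingSpinorEndgameOrtho_of` proved.
`lean check`: rc 0, 0 sorry, 0 warnings (this session).
-/

open Literature.Geometry.Lorentzian
open scoped Manifold ContDiff Topology ENNReal
open Filter Set TopologicalSpace

set_option linter.dupNamespace false

namespace Summit.FinalStateConjecture.FinalStateConjecture.Cruxes.KillingSpinorEndgame.ProposedC3

open Summit.FinalStateConjecture.FinalStateConjecture.Theses.KerrnessPropagates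
open Summit.FinalStateConjecture.FinalStateConjecture.Cruxes.KillingSpinorEndgame.Birth

noncomputable section

variable {X : Type} [TopologicalSpace X] [ChartedSpace E3 X] [IsManifold (𝓡 3) ∞ X]
  [ConnectedSpace X] {D : InitialDataSet (𝓡 3) X}

/-- **Orthochronous sub-extremal horizon-penetrating configuration** (the repaired side conditions of a
recurrence configuration `p = (N; Mᵢ, aᵢ, r₀ᵢ; Λᵢ, cᵢ)`): `|aᵢ| < Mᵢ`, `r₀ᵢ ∈ (r₋, r₊)`, and — NEW, F2 — every
motion `Λᵢ` orthochronous (`Summit.FinalStateConjecture.IsOrthochronous`, the Statement's own predicate), so that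
`boostedKerrBilin Λᵢ cᵢ` is an INGOING (black-hole) Kerr–Schild reference. [cite: ONeill1983, Ch. 9 pp. 233–236] -/
def OrthoConfig {N : ℕ} (M a r₀ : Fin N → ℝ) (mo : Fin N → ↥lorentzGroup × E4) : Prop :=
  ∀ i, Kerr.IsSubextremal (M i) (a i) ∧
    r₀ i ∈ Ioo (Kerr.rMinus (M i) (a i)) (Kerr.rPlus (M i) (a i)) ∧
    Summit.FinalStateConjecture.IsOrthochronous (mo i).1

/-- **The interior lemma of a development** (verbatim the filed hypothesis (ii) / the third conjunct of
CAPTURE's `Q_k`): every honest `C²` Kerr decomposition keeps the future-complete null rays from `Σ` in the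
closure of its exterior. [cite: DafermosLuk2017, Conjecture 1] -/
def InteriorLemma (𝒟 : VacuumCauchyDevelopment D) : Prop :=
  ∀ (O : Set 𝒟.carrier) (d : FinalStateDecomposition 𝒟.toSpacetime O 2),
    (∀ i, Kerr.IsSubextremal (d.mass i) (d.spin i)) →
    O = Summit.FinalStateConjecture.exteriorOf 𝒟.toCauchyDevelopment d.charted →
    Summit.FinalStateConjecture.HasExhaustiveCharts d →
    Summit.FinalStateConjecture.IsFutureOriented d →
    Summit.FinalStateConjecture.RaysStayInClosure 𝒟.toCauchyDevelopment O

/-- **ENDGAME restated (minimal repair F2 + simplification F6)**: there is a regularity `k` such that every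
MGHD (admissible datum, complete `𝓘⁺`) which recurs — the filed clause (i) VERBATIM (`Birth.Recurs`) — to an
ORTHOCHRONOUS sub-extremal horizon-penetrating configuration admits an honest exterior decomposition
(`Birth.HonestExterior`: sub-extremal holes, `O = exteriorOf`, `HasExhaustiveCharts`, `IsFutureOriented`). No
interior-lemma hypothesis, no `Rays` conjunct (both idle, F6). [cite: DafermosLuk2017, Conjecture 1] -/
def KillingSpinorEndgameOrtho : Prop :=
  ∃ k : ℕ, ∀ (X : Type) [TopologicalSpace X] [ChartedSpace E3 X] [IsManifold (𝓡 3) ∞ X]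
    [T2Space X] [SecondCountableTopology X] [ConnectedSpace X] (D : InitialDataSet (𝓡 3) X),
    D ∈ admissibleVacuumData X → ∀ 𝒟 : VacuumCauchyDevelopment D, 𝒟.IsMaximal →
    Summit.FinalStateConjecture.HasCompleteNullInfinity 𝒟.toCauchyDevelopment →
    (∃ (N : ℕ) (M a r₀ : Fin N → ℝ) (mo : Fin N → ↥lorentzGroup × E4),
      OrthoConfig M a r₀ mo ∧ Recurs 𝒟 k N M a r₀ mo) →
    HonestExterior 𝒟

/-- **CAPTURE restated in step** (stmt-17646 with the same repair): tame Christodoulou genericity of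
`Q_k(D)` = every MGHD of `D` has complete `𝓘⁺`, recurs (filed clause (i) verbatim) to an ORTHOCHRONOUS
sub-extremal horizon-penetrating configuration, and satisfies the interior lemma.
[cite: Christodoulou1999, p. A24] [cite: DafermosLuk2017, Conjecture 1] -/
def KerrBasinCaptureOrtho : Prop :=
  ∀ k : ℕ, ∀ (X : Type) [TopologicalSpace X] [ChartedSpace E3 X] [IsManifold (𝓡 3) ∞ X]
    [T2Space X] [SecondCountableTopology X] [ConnectedSpace X],
    InitialDataSet.IsTameChristodoulouGeneric (admissibleVacuumData X)
      (fun D ↦ ∀ 𝒟 : VacuumCauchyDevelopment D, 𝒟.IsMaximal →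
        Summit.FinalStateConjecture.HasCompleteNullInfinity 𝒟.toCauchyDevelopment ∧
        (∃ (N : ℕ) (M a r₀ : Fin N → ℝ) (mo : Fin N → ↥lorentzGroup × E4),
          OrthoConfig M a r₀ mo ∧ Recurs 𝒟 k N M a r₀ mo) ∧
        InteriorLemma 𝒟) 1

/-- **The filed crux implies the restated one** (so the restatement discards no provable content): an
orthochronous configuration is in particular a configuration, and by F6 the filed crux already yields an
honest exterior from recurrence alone (if no honest `(O, d)` existed the filed hypothesis (ii) would hold
vacuously). [folklore] -/
theorem killingSpinorEndgameOrtho_of_filed (h : KillingSpinorEndgame) : KillingSpinorEndgameOrtho := by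
  obtain ⟨k, hk⟩ := h
  refine ⟨k, fun X _ _ _ _ _ _ D hD 𝒟 hmax hscri hrec ↦ ?_⟩
  obtain ⟨N, M, a, r₀, mo, hcfg, hrec⟩ := hrec
  have hrec' : ∃ (N : ℕ) (M a r₀ : Fin N → ℝ) (mo : Fin N → ↥lorentzGroup × E4),
      (∀ i, Kerr.IsSubextremal (M i) (a i) ∧
        r₀ i ∈ Ioo (Kerr.rMinus (M i) (a i)) (Kerr.rPlus (M i) (a i))) ∧ Recurs 𝒟 k N M a r₀ mo :=
    ⟨N, M, a, r₀, mo, fun i ↦ ⟨(hcfg i).1, (hcfg i).2.1⟩, hrec⟩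
  by_cases hex : HonestExterior 𝒟
  · exact hex
  · obtain ⟨O, d, hsub, hO, -, hexh, hfo⟩ :=
      hk X D hD 𝒟 hmax hscri hrec' fun O d hsub hO hexh hfo ↦ (hex ⟨O, d, hsub, hO, hexh, hfo⟩).elim
    exact ⟨O, d, hsub, hO, hexh, hfo⟩

/-- **The restated pair still closes the route**: `MaximalDevelopmentExists → KerrBasinCaptureOrtho →
KillingSpinorEndgameOrtho → FinalStateConjecture`, exactly as the route file's `closes` (tame Christodoulou
genericity is monotone in the property), except that the interior lemma of `Q_k` is now applied HERE to the
honest decomposition delivered by ENDGAME. [cite: Christodoulou1999, p. A24] -/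
theorem closes_restated : MaximalDevelopmentExists → KerrBasinCaptureOrtho → KillingSpinorEndgameOrtho →
    FinalStateConjecture := by
  intro hM hC hE
  obtain ⟨k, hk⟩ := hE
  intro X _ _ _ _ _ _
  have mono : ∀ {P Q : InitialDataSet (𝓡 3) X → Prop},
      (∀ D ∈ admissibleVacuumData X, Q D → P D) →
      InitialDataSet.IsTameChristodoulouGeneric (admissibleVacuumData X) Q 1 →
      InitialDataSet.IsTameChristodoulouGeneric (admissibleVacuumData X) P 1 := by
    intro P Q hPQ hQ D hD
    obtain ⟨e, F, hF, himm, h0, hinj, hadm, hgood⟩ := hQ D ⟨hD.1, fun h ↦ hD.2 (hPQ D hD.1 h)⟩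
    exact ⟨e, F, hF, himm, h0, hinj, hadm,
      fun c hc hmem ↦ hgood c hc ⟨hmem.1, fun h ↦ hmem.2 (hPQ _ hmem.1 h)⟩⟩
  refine mono ?_ (hC k X)
  intro D hD hQ
  refine ⟨hM X D hD, fun 𝒟 h𝒟 ↦ ⟨(hQ 𝒟 h𝒟).1, ?_⟩⟩
  obtain ⟨O, d, hsub, hO, hexh, hfo⟩ := hk X D hD 𝒟 h𝒟 (hQ 𝒟 h𝒟).1 (hQ 𝒟 h𝒟).2.1
  exact ⟨O, d, hsub, hO, (hQ 𝒟 h𝒟).2.2 O d hsub hO hexh hfo, hexh, hfo⟩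

/-! ### The two-stub re-line over the restated crux -/

/-- **Re-lined stub 1 — DYNAMICS** (carries the whole open-problem difficulty): recurrence at a
prover-chosen regularity `k` (filed clause (i) verbatim) to an orthochronous sub-extremal horizon-penetrating
configuration ⇒ ONE convergent global gauge of regularity `3` (`Birth.GlobalGauge 𝒟 3`) to SOME orthochronous
sub-extremal horizon-penetrating configuration `p′` (re-description allowed: charges and motions may be
re-fitted; no `η`-family interface, w1). Content: sub-extremal Kerr asymptotic stability in a horizon-penetrating
lab gauge for all `|a| < M` from unweighted-sup-small ingoing slabs (`ε`-good for every `ε`, same `p`), plus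
`N ≥ 2` decoupling. [cite: DafermosRodnianski2008, Conj. 5.1] [cite: KlainermanSzeftel2023, Thm. 1.1] -/
def Sig.stub_dynamicsOrtho : Prop :=
  ∃ k : ℕ,
  ∀ (X : Type) [TopologicalSpace X] [ChartedSpace E3 X] [IsManifold (𝓡 3) ∞ X]
    [T2Space X] [SecondCountableTopology X] [ConnectedSpace X] (D : InitialDataSet (𝓡 3) X),
    D ∈ admissibleVacuumData X → ∀ 𝒟 : VacuumCauchyDevelopment D, 𝒟.IsMaximal →
    Summit.FinalStateConjecture.HasCompleteNullInfinity 𝒟.toCauchyDevelopment →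
    ∀ (N : ℕ) (M a r₀ : Fin N → ℝ) (mo : Fin N → ↥lorentzGroup × E4),
    OrthoConfig M a r₀ mo → Recurs 𝒟 k N M a r₀ mo →
    ∃ (N' : ℕ) (M' a' r₀' : Fin N' → ℝ) (mo' : Fin N' → ↥lorentzGroup × E4),
      OrthoConfig M' a' r₀' mo' ∧ GlobalGauge 𝒟 3 N' M' a' r₀' mo'

/-- **Re-lined stub 2 — PACKAGING**: a convergent global gauge of regularity `3` to an orthochronous
sub-extremal horizon-penetrating configuration in an MGHD with complete `𝓘⁺` packages into an honest exterior
decomposition (w2's corrected signature: edge = horizon, `C³` horizon graph, orthochronous motions).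
[cite: DafermosLuk2017, Conjecture 1 (b)–(c)] -/
def Sig.stub_packagingOrtho : Prop :=
  ∀ (X : Type) [TopologicalSpace X] [ChartedSpace E3 X] [IsManifold (𝓡 3) ∞ X]
    [T2Space X] [SecondCountableTopology X] [ConnectedSpace X] (D : InitialDataSet (𝓡 3) X),
    D ∈ admissibleVacuumData X → ∀ 𝒟 : VacuumCauchyDevelopment D, 𝒟.IsMaximal →
    Summit.FinalStateConjecture.HasCompleteNullInfinity 𝒟.toCauchyDevelopment →
    ∀ (N : ℕ) (M a r₀ : Fin N → ℝ) (mo : Fin N → ↥lorentzGroup × E4),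
    OrthoConfig M a r₀ mo → GlobalGauge 𝒟 3 N M a r₀ mo → HonestExterior 𝒟

/-- **The two re-lined stubs close the restated crux** (pure logic: dynamics ⇒ one convergent gauge to an
orthochronous `p′` ⇒ honest `(O, d)`). [folklore] -/
theorem killingSpinorEndgameOrtho_of :
    Sig.stub_dynamicsOrtho → Sig.stub_packagingOrtho → KillingSpinorEndgameOrtho := by
  intro hdyn hpack
  obtain ⟨k, hk⟩ := hdyn
  refine ⟨k, fun X _ _ _ _ _ _ D hD 𝒟 hmax hscri hrec ↦ ?_⟩
  obtain ⟨N, M, a, r₀, mo, hcfg, hrec⟩ := hrec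
  obtain ⟨N', M', a', r₀', mo', hcfg', hgg⟩ := hk X D hD 𝒟 hmax hscri N M a r₀ mo hcfg hrec
  exact hpack X D hD 𝒟 hmax hscri N' M' a' r₀' mo' hcfg' hgg

end

end Summit.FinalStateConjecture.FinalStateConjecture.Cruxes.KillingSpinorEndgame.ProposedC3
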